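import Summits.NavierStokesRegularity.FluidComputer.PalasekTowerGermPushedAnchorTol

/-!
# The germ host, XV: THE TOLERANT SLOT `LevelZeroDataTol c₄` — host preparation for every profile whose
# speed maximum decays slower than the push can pay

Cell `ns-blowup`, seat `ns-blowup-ecbridge-3` (g3); GROUP C «BRIDGE SUPPORT» of the route
`PalasekTowerBreakdown` (crux `EpisodeBaseG`, item stmt-NavierStokesRegularity-19179, R2 of record).
Sequel of `PalasekTowerGermPushedAnchorTol.lean` (XIV) over ecbridge-4's `PalasekTowerGermHostPushed.lean`
(p447736, the WEAK slot `LevelZeroDataWeak` and its pushed germ host), whose §4 construction is re-run here, packaged in ONE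
existence statement, on the tolerant width of XIV. LABEL: E–C typing (KERNEL construction: one design
slot, the prescribed level-`0` host of every design filling it). WHAT THIS IS NOT: not Navier–Stokes
evidence — the host is a PRESCRIBED flow whose force is its own NS residual (free before the readout,
`≤ c₄ Y₀` on the first window, zero from `τ₁`); nothing is said about the flow after `τ₀`,
`FirstEpisodeD`, `EpisodeBaseG` or blow-up.

## The three slots, widest last

`LevelZeroData` (XIII has a kernel filler; STRICT test `⟪U, V⟫ > 0` on the argmax, matched germ,
`f(τ₀) = 0`) ⇒ `LevelZeroDataWeak` (ecbridge-4; WEAK test `⟪U, V⟫ ≥ 0`, pushed germ `κ = c₄/2`) ⇒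
**`LevelZeroDataTol c₄`** (this file; TOLERANT test **`⟪U, V⟫ > −c₄Y₀²/8`** on the argmax, the same
pushed germ): `LevelZeroData.tol`, `LevelZeroDataWeak.tol`. Every profile with the three level-`0`
readouts whose free-NS speed maximum decays at relative rate `−½∂ₜ‖u‖²/Y₀² < c₄/8` at `τ₀` is a
prepared host in its singleton class: **`LevelZeroDataTol.hostPreparationD_exact`** — pinned (`Λ = 8`,
`θ = 6/5`), rigid, quiet pushed germ schedule, `u(τ₀) = U`, `∂ₜu(τ₀) = (c₄/2)U + V`, residual `(c₄/2)U`
at `τ₀` faded within the window. For design seats: a viscous-dominated carrier of size `ℓ` at `ν = 1`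
(`⟪U, ΔU⟫(x₀) ≈ −C Y₀²/ℓ²`) passes as soon as `ℓ² > 8C/c₄` — no far pressure push is needed.

References: S. Palasek, arXiv:2605.13827 §3.3 (host preparation before the first readout)
[cite: Palasek2026ElementaryModel, §3.3]; A. J. Majda, A. L. Bertozzi, *Vorticity and Incompressible
Flow* (CUP 2002), §1.8 Prop. 1.16 [cite: MajdaBertozziCUP2002, §1.8 Prop. 1.16]; C. L. Fefferman, Clay
problem description, (4)–(7) [cite: FeffermanClay2006, (4) (5) (6) (7)].
-/

noncomputable section

namespace Summit.NavierStokesRegularity.FluidComputer.PalasekTowerClayBridge.Germ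

open Set Function Filter Topology InnerProductSpace Metric MeasureTheory
open scoped Topology ContDiff RealInnerProductSpace ENNReal

open Literature.Analysis.FluidPDE

/-! ## §1 The tolerant design slot and its pushed germ host -/

/-- **LEVEL-`0` DATA OF A NAMED PROFILE, TOLERANT FORM** (push constant `c₄`): as `LevelZeroData` (smooth,
divergence free, supported in `B̄(0, ρ)`; speed `≤ Y₀` everywhere, `= Y₀` somewhere in the ball; strain
`≥ A₀` in the ball; an `N₀`-core loop in the ball with circulation `≥ N₀^{β−2}`) but with the TOLERANT
first-order anchor test `⟪U, P(ΔU − (U·∇)U)⟫ > −c₄Y₀²/8` on the argmax of `‖U‖` — the push `κ = c₄/2` of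
the register pays for a viscous decay of the speed maximum up to that rate.
[cite: Palasek2026ElementaryModel, §3.3] -/
structure LevelZeroDataTol (c₄ : ℝ) (U : EuclideanSpace ℝ (Fin 3) → EuclideanSpace ℝ (Fin 3)) (ρ : ℝ) :
    Prop where
  /-- the profile is smooth -/
  smooth : ContDiff ℝ ∞ U
  /-- … supported in the closed ball of radius `ρ` -/
  support : tsupport U ⊆ closedBall 0 ρ
  /-- … and divergence free -/
  divFree : VectorCalculus.IsDivFree U
  /-- speed ceiling `Y₀` everywhere -/
  ceiling : ∀ x, ‖U x‖ ≤ TowerRates.wide.Y 0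
  /-- speed floor `Y₀` attained in the ball -/
  floor : ∃ x, ‖x‖ ≤ ρ ∧ TowerRates.wide.Y 0 ≤ ‖U x‖
  /-- strain floor `A₀` attained in the ball -/
  strain : ∃ x, ‖x‖ ≤ ρ ∧ TowerRates.wide.A 0 ≤ ‖fderiv ℝ U x‖
  /-- the level-`0` core loop -/
  core : ∃ (x : EuclideanSpace ℝ (Fin 3)) (γ : ℝ → EuclideanSpace ℝ (Fin 3)),
    ‖x‖ ≤ ρ ∧ ContDiff ℝ 1 γ ∧ γ 0 = γ 1 ∧
      (∀ s ∈ Icc (0 : ℝ) 1, γ s ∈ closedBall x (1 / TowerRates.wide.N 0)) ∧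
      (∀ s ∈ Icc (0 : ℝ) 1, ‖deriv γ s‖ ≤ 8 * Real.pi / TowerRates.wide.N 0) ∧
      TowerRates.wide.N 0 ^ (TowerRates.wide.β - 2) ≤ circulation U γ
  /-- the TOLERANT first-order anchor test at the speed maximum: `⟪U, V⟫ > −c₄Y₀²/8` -/
  anchor : ∀ x, ‖U x‖ = TowerRates.wide.Y 0 →
    -(c₄ * TowerRates.wide.Y 0 ^ 2 / 8) < ⟪U x, accel 1 U x⟫

/-- The weak slot implies the tolerant one, for every push constant `c₄ > 0`. [folklore] -/
theorem LevelZeroDataWeak.tol {U : EuclideanSpace ℝ (Fin 3) → EuclideanSpace ℝ (Fin 3)} {ρ : ℝ}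
    (h : LevelZeroDataWeak U ρ) {c₄ : ℝ} (hc₄ : 0 < c₄) : LevelZeroDataTol c₄ U ρ :=
  ⟨h.smooth, h.support, h.divFree, h.ceiling, h.floor, h.strain, h.core, fun x hx => by
    have h1 := h.anchor x hx
    have h2 : 0 < c₄ * TowerRates.wide.Y 0 ^ 2 / 8 := by
      have := Host.wide_Y_zero_pos; positivity
    linarith⟩

/-- The strict slot implies the tolerant one, for every push constant `c₄ > 0`. [folklore] -/
theorem LevelZeroData.tol {U : EuclideanSpace ℝ (Fin 3) → EuclideanSpace ℝ (Fin 3)} {ρ : ℝ}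
    (h : LevelZeroData U ρ) {c₄ : ℝ} (hc₄ : 0 < c₄) : LevelZeroDataTol c₄ U ρ :=
  h.weak.tol hc₄

namespace LevelZeroDataTol

variable {c₄ : ℝ} {U : EuclideanSpace ℝ (Fin 3) → EuclideanSpace ℝ (Fin 3)} {ρ : ℝ}
  (h : LevelZeroDataTol c₄ U ρ)
include h

/-- The tolerant test in the `κ = c₄/2` form used by `exists_pushed_line_anchor_tol`. [folklore] -/
theorem anchor_half (x : EuclideanSpace ℝ (Fin 3)) (hx : ‖U x‖ = TowerRates.wide.Y 0) :
    -(c₄ / 2 * TowerRates.wide.Y 0 ^ 2 / 4) < ⟪U x, accel 1 U x⟫ := by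
  have := h.anchor x hx
  linarith

section Push

variable (hc₄ : 0 < c₄)
include hc₄

/-- **EVERY TOLERANT-SLOT PROFILE HAS A PREPARED HOST IN ITS SINGLETON CLASS** (one packaged statement;
the construction is ecbridge-4's pushed germ host of `PalasekTowerGermHostPushed.lean` §4 run on the
tolerant width of XIV): a box schedule `S` on the wide rates — zero datum, radius `ρ`, push constant `c₄`,
force = the NS residual of the pushed germ `(1 − (c₄/2)(1 − t)) • (U + σline s₀ t • V)` faded out inside
the first window — which is pinned (`Λ = 8`, `θ = 6/5`), rigid, quiet, has `τ₀ = 1`, is PREPARED in its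
singleton class (`HostPreparationD (HostClass.exact S)`), and carries a registered globally anchored
level-`0` stage whose velocity at `τ₀` IS `U`. [cite: Palasek2026ElementaryModel, §3.3] -/
theorem exists_preparedHost (hc₄' : c₄ ≤ 1) :
    ∃ S : Schedule TowerRates.wide, S.radius = ρ ∧ S.c₄ = c₄ ∧ S.τ 0 = 1 ∧
      S.Pins 8 (6 / 5) ∧ S.Rigid ∧ S.Quiet ∧ HostPreparationD (HostClass.exact S) ∧
        ∃ s : Stage 1 TowerRates.wide S (Margins.routeG TowerRates.wide) 0, s.u 1 = U := by
  have hY := Host.wide_Y_zero_pos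
  have hUc : HasCompactSupport U :=
    (isCompact_closedBall (0 : EuclideanSpace ℝ (Fin 3)) ρ).of_isClosed_subset (isClosed_tsupport U)
      h.support
  have hκ0 : (0 : ℝ) < c₄ / 2 := by positivity
  have hκ1 : c₄ / 2 ≤ 1 := by linarith
  -- the tolerant width (XIV)
  obtain ⟨s₀, hs₀, hs₀h, -, hanch⟩ := exists_pushed_line_anchor_tol (ν := 1) h.smooth hUc hY hκ0
    h.ceiling h.anchor_half
  -- the residual of the pushed germ at `τ₀ = 1` is the push `(c₄/2) • U`, of norm `≤ c₄Y₀/2`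
  have h0 : ∀ x, ‖germResid 1 U (αpush (c₄ / 2)) (βpush (c₄ / 2) s₀) 1 x‖ ≤
      c₄ * TowerRates.wide.Y 0 / 2 := by
    intro x
    rw [germResid_eq_smul_of_pushed h.smooth hUc (αpush_one _) (deriv_αpush_one _) (βpush_one _ _)
      (deriv_βpush_one _ hs₀.ne') x, norm_smul, Real.norm_eq_abs, abs_of_pos hκ0]
    have := h.ceiling x
    nlinarith
  -- the fade window inside the first window
  obtain ⟨ε', hε', hwin'⟩ := exists_window_norm_germResid_le_of_le (ν := 1) h.smooth hUc
    (contDiff_αpush _) (contDiff_βpush _ _) h.support (mul_pos hc₄ hY) h0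
  set ε := min ε' Host.wfirst with hεdef
  have hε : 0 < ε := lt_min hε' Host.wfirst_pos
  have hεw : ε ≤ Host.wfirst := min_le_right _ _
  have hwin : ∀ t ∈ Icc (1 : ℝ) (1 + ε), ∀ x : EuclideanSpace ℝ (Fin 3),
      ‖germResid 1 U (αpush (c₄ / 2)) (βpush (c₄ / 2) s₀) t x‖ ≤ c₄ * TowerRates.wide.Y 0 :=
    fun t ht x => hwin' t ⟨ht.1, ht.2.trans (by linarith [min_le_left ε' Host.wfirst])⟩ x
  -- the force: the residual, faded out on `[1, 1 + ε]`
  set f := germForce 1 U (αpush (c₄ / 2)) (βpush (c₄ / 2) s₀) (1 + ε) ε with hfdef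
  have hf1 : ContDiff ℝ ∞ (uncurry f) :=
    contDiff_uncurry_germForce h.smooth hUc (contDiff_αpush _) (contDiff_βpush _ _)
  have hf2 : HasCompactSupport (uncurry f) :=
    hasCompactSupport_germForce h.smooth hUc hε h.support (fun _ ht => αpush_of_nonpos ht)
      (fun _ ht => βpush_of_nonpos ht)
  have hf3 : ∀ t, Host.τfirst ≤ t → ∀ x, f t x = 0 := by
    intro t ht x
    rw [Host.τfirst_eq] at ht
    exact germForce_eq_zero_of_ge hε (by linarith) x
  have hf4 : ∀ t ∈ Icc (1 : ℝ) Host.τfirst, ∀ x, ‖f t x‖ ≤ c₄ * TowerRates.wide.Y 0 :=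
    fun _ ht x => norm_germForce_le_of_window hε (mul_pos hc₄ hY).le hwin ht.1 x
  have hf5 : ∀ t x, ρ < ‖x‖ → f t x = 0 := fun t x hx =>
    germForce_eq_zero_of_norm_gt h.smooth hUc h.support t hx
  have hf6 : ∀ {t : ℝ}, t ≤ 1 → ∀ x,
      f t x = germResid 1 U (αpush (c₄ / 2)) (βpush (c₄ / 2) s₀) t x :=
    fun ht x => germForce_eq_germResid hε (by linarith) x
  -- the schedule
  set S := Schedule.ofBox 0 f ρ c₄ hc₄' contDiff_const HasCompactSupport.zero hf1 hf2 hf3 hf4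
    with hSdef
  have hR : S.Rigid := Schedule.ofBox_rigid _ _ _ _ _ _ _
  have hQ : S.Quiet := Schedule.ofBox_quiet _ _ _ _ _ _ _
  have hP : S.Pins 8 (6 / 5) := Schedule.ofBox_pins _ _ _ _ _ _ _ (fun _ _ => rfl) hf5
  have hτ0 : S.τ 0 = 1 := Host.windowTime_zero
  have hc₁ : S.c₁ = 1 := rfl
  have hc₂ : S.c₂ = 5 / 3 := rfl
  -- the flow on the slab `[0, 1]`
  set u := germ 1 U (αpush (c₄ / 2)) (βpush (c₄ / 2) s₀) with hudef
  set q := germPres 1 U (βpush (c₄ / 2) s₀) with hqdef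
  have hcl : IsClassicalNSSolutionOn (Icc 0 (S.τ 0)) 1 S.f u q := by
    rw [hτ0]
    have hb := isClassicalNSSolutionOn_germ (ν := 1) (α := αpush (c₄ / 2)) (β := βpush (c₄ / 2) s₀)
      h.smooth hUc (contDiff_αpush _) (contDiff_βpush _ _) h.divFree one_pos
    refine ⟨hb.smooth_velocity, hb.smooth_pressure, fun t ht x => ?_, hb.divFree⟩
    have hf : S.f t x = germResid 1 U (αpush (c₄ / 2)) (βpush (c₄ / 2) s₀) t x := hf6 ht.2 x
    rw [hf]
    exact hb.momentum t ht x
  have hu1 : u 1 = U := germ_pushed_one 1 U _ _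
  have hu0 : u 0 = 0 := germ_pushed_zero 1 U _ _
  have hlt : ∀ t : ℝ, t < 1 → ∀ x, ‖u t x‖ < TowerRates.wide.Y 0 := fun t ht x =>
    norm_germ_pushed_lt hκ0 hκ1 hs₀ hs₀h hanch ht x
  have hle : ∀ t : ℝ, t ≤ 1 → ∀ x, ‖u t x‖ ≤ TowerRates.wide.Y 0 := fun t ht x =>
    norm_germ_pushed_le hκ0 hκ1 hs₀ hs₀h h.ceiling hanch ht x
  have hen : ∃ C : ℝ≥0∞, C < ⊤ ∧ ∀ t ∈ Icc 0 (S.τ 0), ∫⁻ x, ‖u t x‖ₑ ^ 2 ≤ C := by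
    rw [hτ0]
    exact energy_germ (ν := 1) h.smooth hUc (fun t ht => abs_αpush_le hκ0.le hκ1 ht.2)
      (fun _ ht => abs_βpush_le hκ0.le hκ1 hs₀ ht.2)
  -- the registered level-0 stage
  have hstage : ∃ s : Stage 1 TowerRates.wide S (Margins.routeG TowerRates.wide) 0, s.u 1 = U := by
    refine ⟨{ u := u, p := q, classical := hcl, initial := ?_, energy := hen,
              floor := ?_, ceiling := ?_, quiet := ?_, margin := ?_ }, hu1⟩
    · rw [hu0]; rfl
    · intro j hj
      obtain rfl := Nat.le_zero.1 hj
      obtain ⟨x, hx, hfl⟩ := h.floor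
      refine ⟨x, hx, ?_⟩
      rw [hτ0, hc₁, one_mul, hu1]
      exact hfl
    · intro j hj t ht x
      obtain rfl := Nat.le_zero.1 hj
      rw [hτ0] at ht
      rw [hc₂]
      have := hle t ht.2 x
      linarith
    · intro j hj
      exact absurd hj (by omega)
    · show (∀ j, j ≤ 0 →
          ∃ x, ‖x‖ ≤ S.radius ∧ S.c₁ * TowerRates.wide.A j ≤ ‖fderiv ℝ (u (S.τ j)) x‖) ∧
        (S.AnchorGlobal u ∧ (S.Rigid ∧ CoreLedger TowerRates.wide S 0 u))
      refine ⟨?_, ?_, hR, ?_⟩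
      · intro j hj
        obtain rfl := Nat.le_zero.1 hj
        obtain ⟨x, hx, hst⟩ := h.strain
        refine ⟨x, hx, ?_⟩
        rw [hτ0, hc₁, one_mul, hu1]
        exact hst
      · intro t ht x
        rw [hτ0] at ht
        rw [hc₁, one_mul]
        exact hlt t ht.2 x
      · intro j hj
        obtain rfl := Nat.le_zero.1 hj
        obtain ⟨x, γ, hx, hγ, hcl', hball, hspeed, hcirc⟩ := h.core
        refine ⟨x, γ, hx, hγ, hcl', hball, hspeed, ?_⟩
        rw [hτ0, hc₁, one_mul, hu1]
        exact hcirc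
  obtain ⟨s, hs⟩ := hstage
  exact ⟨S, rfl, rfl, hτ0, hP, hR, hQ, (hostPreparationD_exact_iff _).2 ⟨hP, hR, hQ, ⟨s⟩⟩, s, hs⟩

/-- **THE HOST `S⋆(U, c₄)` OF A TOLERANT-SLOT PROFILE** (a choice from `exists_preparedHost`). [folklore] -/
def host (hc₄' : c₄ ≤ 1) : Schedule TowerRates.wide :=
  (h.exists_preparedHost hc₄ hc₄').choose

/-- Its ball radius is `ρ`. [folklore] -/
theorem host_radius (hc₄' : c₄ ≤ 1) : (h.host hc₄ hc₄').radius = ρ :=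
  (h.exists_preparedHost hc₄ hc₄').choose_spec.1

/-- Its push constant is `c₄`. [folklore] -/
theorem host_c₄ (hc₄' : c₄ ≤ 1) : (h.host hc₄ hc₄').c₄ = c₄ :=
  (h.exists_preparedHost hc₄ hc₄').choose_spec.2.1

/-- Its readout time is `τ₀ = 1`. [folklore] -/
theorem host_τ_zero (hc₄' : c₄ ≤ 1) : (h.host hc₄ hc₄').τ 0 = 1 :=
  (h.exists_preparedHost hc₄ hc₄').choose_spec.2.2.1

/-- It is pinned (`Λ = 8`, `θ = 6/5`). [folklore] -/
theorem host_pins (hc₄' : c₄ ≤ 1) : (h.host hc₄ hc₄').Pins 8 (6 / 5) :=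
  (h.exists_preparedHost hc₄ hc₄').choose_spec.2.2.2.1

/-- It is rigid. [folklore] -/
theorem host_rigid (hc₄' : c₄ ≤ 1) : (h.host hc₄ hc₄').Rigid :=
  (h.exists_preparedHost hc₄ hc₄').choose_spec.2.2.2.2.1

/-- It is quiet. [folklore] -/
theorem host_quiet (hc₄' : c₄ ≤ 1) : (h.host hc₄ hc₄').Quiet :=
  (h.exists_preparedHost hc₄ hc₄').choose_spec.2.2.2.2.2.1

/-- **HOST PREPARATION IN THE SINGLETON CLASS OF `S⋆(U, c₄)`** — for EVERY profile filling the tolerant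
slot at push constant `c₄ ∈ (0, 1]`. [cite: Palasek2026ElementaryModel, §3.3] -/
theorem hostPreparationD_host (hc₄' : c₄ ≤ 1) :
    HostPreparationD (HostClass.exact (h.host hc₄ hc₄')) :=
  (h.exists_preparedHost hc₄ hc₄').choose_spec.2.2.2.2.2.2.1

/-- It carries a registered level-`0` stage whose readout slice is `U`. [cite: Palasek2026ElementaryModel, §3.3] -/
theorem exists_stage_host (hc₄' : c₄ ≤ 1) :
    ∃ s : Stage 1 TowerRates.wide (h.host hc₄ hc₄') (Margins.routeG TowerRates.wide) 0, s.u 1 = U :=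
  (h.exists_preparedHost hc₄ hc₄').choose_spec.2.2.2.2.2.2.2

/-- **The crux for this design reduces to its episode**: `FirstEpisodeD` over the singleton class of
`S⋆(U, c₄)` gives `EpisodeBaseG`. [cite: Palasek2026ElementaryModel, §4] -/
theorem episodeBaseG_of_firstEpisodeD (hc₄' : c₄ ≤ 1)
    (hF : FirstEpisodeD (HostClass.exact (h.host hc₄ hc₄'))) : EpisodeBaseG :=
  episodeBaseG_of_exact _ (h.hostPreparationD_host hc₄ hc₄') hF

end Push

end LevelZeroDataTol

end Summit.NavierStokesRegularity.FluidComputer.PalasekTowerClayBridge.Germ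

end
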